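import Summits.KontsevichZagierPeriods.KontsevichZagierPeriods.Theorems.SymplecticScissorsRealOnePeriodRelationsTorsionCurveSmooth
import Literature.NumberTheory.Transcendental.CurvePeriodsPuncturedLineProofs

/-!
# Crux `RealOnePeriodRelations` (stmt-KontsevichZagierPeriods-10042), line `nash-retraction-thin-strip`, reshape 10:
# de Rham reduction on the torsion-punctured curve `C_T` (stub `stub_formReductionP`), I: tangent calculus

First of five files proving `stub_formReductionP` (every polynomial 1-form over `ℚ̄` on
`C_T = {y² = f(x), w ∏_{t∈T}(x − t) = 1}` is `a θ₀ + b θ₁ + Σ e_t dx/(x − t) + Σ o_t dx/((x − t) y) + dF + ν`).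
Here: the tangent line of `C_T` in terms of `θ₀^C = ι^*θ₀` (`exists_tangent_coeff`: `t = (2c y, c f′(x), −w² ∏′ t₀)`,
`θ₀^C(t) = 2c`, from the Bézout identity `V f′ − U f = D`), and the basic congruences of forms on `C_T`:
`Q dx ≡ Q y θ₀^C` (`vanishesOn_rule_dx`), `Q y dx ≡ Q f θ₀^C` (rule (a)), `Q dy ≡ ½ Q f′ θ₀^C` (rule (b)),
`Q dw ≡ −Q w² ∏′ dx` (rule (w)).
[cite: HuberWustholz2022, §3.3.1, §13.2]
-/

noncomputable section

open scoped BigOperators Topology PeriodPair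
open Set Filter MvPolynomial Complex
open Literature.NumberTheory.Transcendental Literature.NumberTheory.Transcendental.CurvePeriods
open Literature.NumberTheory.Transcendental.CurvePeriods.Ell

namespace Summit.KontsevichZagierPeriods.SymplecticScissors.RealOnePeriodRelations

namespace TorsionLayer

variable (L : PeriodPair)

/-! ## Tangent calculus on `C_T` -/

/-- `Dι(p) t = (t₀, t₁)`. [folklore] -/
theorem sum_pderiv_iota (p t : Fin 3 → ℂ) (j : Fin 2) :
    ∑ i, eval p (pderiv i (iota j)) * t i = ![t 0, t 1] j := by
  fin_cases j <;> simp [iota, Fin.sum_univ_three, pderiv_X]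

/-- `θ₀^C(p)(t) = θ₀(ι p)(t₀, t₁)`. [folklore] -/
theorem Theta0_pair (p t : Fin 3 → ℂ) :
    ∑ i, eval p (Theta0 L i) * t i = ∑ k, eval ![p 0, p 1] (theta0 L k) * ![t 0, t 1] k := by
  rw [Theta0, formPullback_pair, iota_eval]
  exact Finset.sum_congr rfl fun k _ => by rw [sum_pderiv_iota]

/-- `θ₀^C(p)(t)` in closed form: `(1/D)(−U(p₀) p₁ t₀ + 2 V(p₀) t₁)`. [folklore] -/
theorem Theta0_apply (p t : Fin 3 → ℂ) :
    ∑ i, eval p (Theta0 L i) * t i =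
      -(1 / Weier.disc (A L) (B L)) * eval ![p 0, p 1] (Weier.uPol (A L) (B L)) * p 1 * t 0 +
        2 / Weier.disc (A L) (B L) * eval ![p 0, p 1] (Weier.vPol (A L) (B L)) * t 1 := by
  rw [Theta0_pair]
  simp only [Fin.sum_univ_two, Ell.theta0, Weier.theta0, Matrix.cons_val_zero, Matrix.cons_val_one,
    map_mul, eval_C, eval_X]

/-- `θ₁^C = x · θ₀^C`. [folklore] -/
theorem Theta1_eq : Theta1 L = (X 0 : MvPolynomial (Fin 3) ℂ) • Theta0 L := by
  funext i
  simp only [Theta1, Theta0, Ell.theta1, formPullback, Pi.smul_apply, smul_eq_mul, map_mul,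
    bind₁_X_right, Finset.mul_sum]
  refine Finset.sum_congr rfl fun j _ => ?_
  simp [iota]
  ring

/-- `∂f/∂x` at a point: `3 p₀² + A`. [folklore] -/
theorem eval_pderiv_zero_fPoly3 (p : Fin 3 → ℂ) : eval p (pderiv 0 (fPoly3 L)) = 3 * p 0 ^ 2 + A L := by
  rw [pderiv_fPoly3]
  simp

/-- **The tangent line of `C_T` in terms of `θ₀^C`**: at `p ∈ C_T`, every tangent vector is
`t = (2c p₁, c f′(p₀), −p₂² ∏′(p₀) t₀)` with `θ₀^C(p)(t) = 2c`. [folklore] -/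
theorem exists_tangent_coeff {T : Finset ℂ} {p t : Fin 3 → ℂ} (hp : p ∈ (curveP L T).points)
    (ht : t ∈ (curveP L T).tangentSpace p) :
    ∃ c : ℂ, t 0 = 2 * c * p 1 ∧ t 1 = c * (3 * p 0 ^ 2 + A L) ∧
      (∑ i, eval p (Theta0 L i) * t i) = 2 * c ∧
      t 2 = -(p 2 ^ 2 * eval p (pderiv 0 (prodP T))) * t 0 := by
  rw [mem_points_curveP_iff] at hp
  rw [mem_tangentSpace_curveP_iff] at ht
  obtain ⟨hcub, hw⟩ := hp
  obtain ⟨ht1, ht2⟩ := ht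
  have ht2' : t 2 = -(p 2 ^ 2 * eval p (pderiv 0 (prodP T))) * t 0 := by
    linear_combination (-(t 2)) * hw + (p 2) * ht2
  have hb := Weier.eval_bezout (A L) (B L) ![p 0, p 1]
  rw [Weier.eval_pderiv_zero_fPoly, Weier.eval_fPoly] at hb
  simp only [Matrix.cons_val_zero] at hb
  have hD := disc_ne_zero L
  have key : ∀ c : ℂ, t 0 = 2 * c * p 1 → t 1 = c * (3 * p 0 ^ 2 + A L) →
      (∑ i, eval p (Theta0 L i) * t i) = 2 * c := by
    intro c h0 h1
    rw [Theta0_apply, h0, h1]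
    field_simp
    linear_combination (-(c * eval ![p 0, p 1] (Weier.uPol (A L) (B L)))) * hcub + c * hb
  by_cases hy : p 1 = 0
  · have hf : 3 * p 0 ^ 2 + A L ≠ 0 := fderiv_ne_zero_of_y_eq_zero L hcub hy
    have h0 : t 0 = 0 := by
      have h : (3 * p 0 ^ 2 + A L) * t 0 = 0 := by linear_combination -ht1 + (2 * t 1) * hy
      exact (mul_eq_zero.mp h).resolve_left hf
    refine ⟨t 1 / (3 * p 0 ^ 2 + A L), ?_, ?_, key _ ?_ ?_, ht2'⟩
    · rw [h0, hy]; ring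
    · field_simp
    · rw [h0, hy]; ring
    · field_simp
  · refine ⟨t 0 / (2 * p 1), ?_, ?_, key _ ?_ ?_, ht2'⟩
    · field_simp
    · field_simp
      linear_combination ht1
    · field_simp
    · field_simp
      linear_combination ht1

/-! ## The basic congruences of forms on `C_T` -/

variable (T : Finset ℂ)

/-- **`Q dx ≡ (Q y) θ₀^C`** (`dx = y · dx/y`). [folklore] -/
theorem vanishesOn_rule_dx : ∀ (L : PeriodPair) (T : Finset ℂ) (Q : MvPolynomial (Fin 3) ℂ), VanishesOn (curveP L T) ((![Q, 0, 0] : Fin 3 → MvPolynomial (Fin 3) ℂ) - (Q * X 1) • Theta0 L) := by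
  intro L T Q p hp t ht
  obtain ⟨c, h0, h1, hΘ, h2⟩ := exists_tangent_coeff L hp ht
  have e : ∑ i, eval p ((((![Q, 0, 0] : Fin 3 → MvPolynomial (Fin 3) ℂ) - (Q * X 1) • Theta0 L)) i) * t i =
      eval p Q * t 0 - eval p Q * p 1 * ∑ i, eval p (Theta0 L i) * t i := by
    simp only [Pi.sub_apply, Pi.smul_apply, smul_eq_mul, map_sub, map_mul, eval_X, sub_mul,
      Finset.sum_sub_distrib, Fin.sum_univ_three, Matrix.cons_val_zero,
      Matrix.cons_val_one, Matrix.cons_val_two, Matrix.head_cons, Matrix.tail_cons, map_zero,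
      zero_mul, add_zero]
    ring
  rw [e, hΘ, h0]
  ring

/-- **Rule (a): `Q y dx ≡ (Q f) θ₀^C`** (`y dx = y² dx/y = f dx/y`). [folklore] -/
theorem vanishesOn_rule_a (Q : MvPolynomial (Fin 3) ℂ) :
    VanishesOn (curveP L T)
      ((![Q * X 1, 0, 0] : Fin 3 → MvPolynomial (Fin 3) ℂ) - (Q * fPoly3 L) • Theta0 L) := by
  intro p hp t ht
  obtain ⟨c, h0, h1, hΘ, h2⟩ := exists_tangent_coeff L hp ht
  have hcub := ((mem_points_curveP_iff L T p).1 hp).1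
  have e : ∑ i, eval p ((((![Q * X 1, 0, 0] : Fin 3 → MvPolynomial (Fin 3) ℂ) -
      (Q * fPoly3 L) • Theta0 L)) i) * t i =
      eval p Q * p 1 * t 0 - eval p Q * (p 0 ^ 3 + A L * p 0 + B L) * ∑ i, eval p (Theta0 L i) * t i := by
    simp only [Pi.sub_apply, Pi.smul_apply, smul_eq_mul, map_sub, map_mul, eval_X, sub_mul,
      Finset.sum_sub_distrib, Fin.sum_univ_three, Matrix.cons_val_zero,
      Matrix.cons_val_one, Matrix.cons_val_two, Matrix.head_cons, Matrix.tail_cons, map_zero,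
      zero_mul, add_zero, eval_fPoly3]
    ring
  rw [e, hΘ, h0]
  linear_combination (2 * c * eval p Q) * hcub

/-- **Rule (b): `Q dy ≡ (Q f′/2) θ₀^C`** (`dy = (f′/2y) dx`). [folklore] -/
theorem vanishesOn_rule_b (Q : MvPolynomial (Fin 3) ℂ) :
    VanishesOn (curveP L T)
      ((![0, Q, 0] : Fin 3 → MvPolynomial (Fin 3) ℂ) - (Q * (C (1 / 2) * pderiv 0 (fPoly3 L))) • Theta0 L) := by
  intro p hp t ht
  obtain ⟨c, h0, h1, hΘ, h2⟩ := exists_tangent_coeff L hp ht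
  have e : ∑ i, eval p ((((![0, Q, 0] : Fin 3 → MvPolynomial (Fin 3) ℂ) -
      (Q * (C (1 / 2) * pderiv 0 (fPoly3 L))) • Theta0 L)) i) * t i =
      eval p Q * t 1 - eval p Q * (1 / 2 * (3 * p 0 ^ 2 + A L)) * ∑ i, eval p (Theta0 L i) * t i := by
    simp only [Pi.sub_apply, Pi.smul_apply, smul_eq_mul, map_sub, map_mul, eval_C, sub_mul,
      Finset.sum_sub_distrib, Fin.sum_univ_three, Matrix.cons_val_zero,
      Matrix.cons_val_one, Matrix.cons_val_two, Matrix.head_cons, Matrix.tail_cons, map_zero,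
      zero_mul, add_zero, zero_add, eval_pderiv_zero_fPoly3]
    ring
  rw [e, hΘ, h1]
  ring

/-- **Rule (w): `Q dw ≡ −Q w² ∏′ dx`** (`d(w ∏) = 0` and `w ∏ = 1` on `C_T`). [folklore] -/
theorem vanishesOn_rule_w (Q : MvPolynomial (Fin 3) ℂ) :
    VanishesOn (curveP L T)
      ((![Q * X 2 ^ 2 * pderiv 0 (prodP T), 0, Q] : Fin 3 → MvPolynomial (Fin 3) ℂ)) := by
  intro p hp t ht
  obtain ⟨c, h0, h1, hΘ, h2⟩ := exists_tangent_coeff L hp ht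
  simp only [Fin.sum_univ_three, Matrix.cons_val_zero, Matrix.cons_val_one, Matrix.cons_val_two,
    Matrix.head_cons, Matrix.tail_cons, map_mul, map_pow, eval_X, map_zero, zero_mul, add_zero]
  rw [h2]
  ring

/-- A multiple `P θ₀^C` with `P = 0` on `C_T` vanishes on `C_T`. [folklore] -/
theorem vanishesOn_smul_Theta0 {P : MvPolynomial (Fin 3) ℂ} (h : ∀ p ∈ (curveP L T).points, eval p P = 0) :
    VanishesOn (curveP L T) (P • Theta0 L) :=
  vanishesOn_of_eval_eq_zero _ _ fun p hp i => by simp [h p hp]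

/-- A form `P dx` with `P = 0` on `C_T` vanishes on `C_T`. [folklore] -/
theorem vanishesOn_dx {P : MvPolynomial (Fin 3) ℂ} (h : ∀ p ∈ (curveP L T).points, eval p P = 0) :
    VanishesOn (curveP L T) (![P, 0, 0] : Fin 3 → MvPolynomial (Fin 3) ℂ) :=
  vanishesOn_of_eval_eq_zero _ _ fun p hp i => by fin_cases i <;> simp [h p hp]


/-! ## Small algebra of forms -/

/-- [folklore] -/
theorem vanishesOn_neg {Z : CurveData} {ν : Fin Z.n → MvPolynomial (Fin Z.n) ℂ} (h : VanishesOn Z ν) :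
    VanishesOn Z (-ν) := by
  simpa using h.smul (-1)

/-- [folklore] -/
theorem vanishesOn_sub {Z : CurveData} {ν₁ ν₂ : Fin Z.n → MvPolynomial (Fin Z.n) ℂ}
    (h₁ : VanishesOn Z ν₁) (h₂ : VanishesOn Z ν₂) : VanishesOn Z (ν₁ - ν₂) := by
  simpa [sub_eq_add_neg] using h₁.add (vanishesOn_neg h₂)

/-- `(c R) ω = c (R ω)`. [folklore] -/
theorem C_mul_smul_form (c : ℂ) (R : MvPolynomial (Fin 3) ℂ) (ω : Fin 3 → MvPolynomial (Fin 3) ℂ) :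
    (C c * R) • ω = c • (R • ω) := by
  funext k
  simp only [Pi.smul_apply, smul_eq_mul, smul_eq_C_mul, mul_assoc]

/-- `(C c) ω = c ω`. [folklore] -/
theorem C_smul_form (c : ℂ) (ω : Fin 3 → MvPolynomial (Fin 3) ℂ) :
    (C c : MvPolynomial (Fin 3) ℂ) • ω = c • ω := by
  funext k
  simp only [Pi.smul_apply, smul_eq_mul, smul_eq_C_mul]

/-- Forms `P ω` with `P`, `ω` over `ℚ̄` are over `ℚ̄`. [folklore] -/
theorem hasAlgCoeffs_smul_form {P : MvPolynomial (Fin 3) ℂ} (hP : HasAlgCoeffs P)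
    {ω : Fin 3 → MvPolynomial (Fin 3) ℂ} (hω : ∀ i, HasAlgCoeffs (ω i)) : ∀ i, HasAlgCoeffs ((P • ω) i) :=
  fun i => hP.mul (hω i)

/-- [folklore] -/
theorem hasAlgCoeffs_vec3 {P Q R : MvPolynomial (Fin 3) ℂ} (hP : HasAlgCoeffs P) (hQ : HasAlgCoeffs Q)
    (hR : HasAlgCoeffs R) : ∀ i, HasAlgCoeffs ((![P, Q, R] : Fin 3 → MvPolynomial (Fin 3) ℂ) i) := by
  intro i
  fin_cases i
  · simpa using hP
  · simpa using hQ
  · simpa using hR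

/-- `θ₀^C` is over `ℚ̄`. [folklore] -/
theorem hasAlgCoeffs_Theta0 (h₂ : IsAlgebraic ℚ L.g₂) (h₃ : IsAlgebraic ℚ L.g₃) : ∀ i, HasAlgCoeffs (Theta0 L i) :=
  HasAlgCoeffs.formPullback hasAlgCoeffs_iota (Ell.hasAlgCoeffs_theta0 L h₂ h₃)

/-- `θ₁^C` is over `ℚ̄`. [folklore] -/
theorem hasAlgCoeffs_Theta1 (h₂ : IsAlgebraic ℚ L.g₂) (h₃ : IsAlgebraic ℚ L.g₃) : ∀ i, HasAlgCoeffs (Theta1 L i) :=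
  HasAlgCoeffs.formPullback hasAlgCoeffs_iota (Ell.hasAlgCoeffs_theta1 L h₂ h₃)


end TorsionLayer

end Summit.KontsevichZagierPeriods.SymplecticScissors.RealOnePeriodRelations

end
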